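/-
Copyright (c) 2026 the pub-hodgecm-mathlib formalisation cell (harness21).  Prover seat hodgecm-mathlib-K2E2-p13 (g3), HCML Track B «K2-LIT» (build stream 29),
h413 = `stmt-HodgeConjecture-24833`, line `K2_E3_EllipticInputs`, unit U12 «Characters», socket #11 road (11-SC), letter (SC-an), road «FC» (finite conjugation
measure), brick for (FC-8) F3 «THE BOX IS TORUS-INVARIANT» (K2E3-p23 (g4) head `K2/STATUS.md` 2026-09-04T04:15:42Z verbatim; (SC-an) lead K2E3-p14 (g4) RULINGS #20 (R20-1)).
-/
import Summits.HodgeConjecture.HodgeConjecture.Theorems.K2E3FinConjCartanCover          -- ★ (FC-8) F1 p857230 (K2E3-p23 (g4)): `mul_mem_box_iff` (left `K₀`-invariance of `K₀ S₀ K₀`); brings ★ `HermitianLattice.unitaryInt`, `mem_unitaryInt_iff`, frame 𝔉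
import Summits.HodgeConjecture.HodgeConjecture.Theorems.K2E3DiagonalCollisionMeasure   -- ★ (FC-5) p857212 (this seat): `torusOne_mem_unitaryGroupOfForm` (the `t_a` token)
import Literature.NumberTheory.Automorphic.ValuedFieldValuativeRelBridge                -- ★ `v_eq_one_iff_valuation_eq_one` (`Valued.v` ↔ `valuation` on the unit sphere)
import HarnessLib

/-!
# h413 ∕ Track B «K2-LIT», (SC-an) line, road «FC» — (FC-8) F3 input: THE BOX `K₀S₀K₀ ∩ {h | c h c⁻¹ ∈ K₀S₀K₀}` IS INVARIANT UNDER THE `𝒪^×`-TORUS `t_a = diag(a, 1, σ(a)⁻¹)`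
# (Bruhat–Tits 1972 (4.4.3); Rogawski 1990 §1.10)

Cell `pub/hodgecm-mathlib`, Track B «K2-LIT», crux H413 = `stmt-HodgeConjecture-24833` (lane `--supports … --as helper`, count-neutral).  THEOREMS ONLY (no `def`,
no `instance`, no `notation`, no named-fact hypothesis, no `sorry`).

WHAT.  The `hB` input of ★ (FC-5b)∕(FC-5c) `K2E3TorusNearCollisionBound.measure_inter_nearCollision_le` for the set the (FC-8) assembly `K2E3FinConjRankOne` F3
(K2E3-p23 (g4)) averages over: with `U = U(σ, Φ₃)(K)`, `K₀ = unitaryInt σ Φ₃ = U ∩ GL₃(𝒪)` (★ `HermitianLattice.unitaryInt`), `S₀ ⊆ U` any set, `c ∈ U` any element with a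
DIAGONAL matrix (the ray power `tₙ = (aⁿ)⁻¹` of ★ F1 `coe_inv_pow_eq_diagonal`), and `a ∈ 𝒪^×` (`valuation a = 1`):
**`t_a • (K₀S₀K₀ ∩ {h | c h c⁻¹ ∈ K₀S₀K₀}) = K₀S₀K₀ ∩ {h | c h c⁻¹ ∈ K₀S₀K₀}`** (`torusOne_smul_box_eq`, head = p23's bytes 04:15:42Z) — because (§1) `t_a ∈ K₀`
(`glDiagonal_mem_unitaryInt`: a diagonal unitary with unit entries is integral with integral inverse), (§2) two elements of `U` with diagonal matrices commute
(`mul_eq_mul_of_diagonal`), so `c (t_a h) c⁻¹ = t_a (c h c⁻¹)`, and (§3) the box `K₀S₀K₀` is left-`K₀`-invariant (★ F1 `mul_mem_box_iff`).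

HONEST LABEL: HC_CM is proved only modulo the 7 printed citations (2 remaining named inputs: hLiu418 = `stmt-HodgeConjecture-24832`, h413 =
`stmt-HodgeConjecture-24833`) until rung 0 closes; count-neutral helper (group bookkeeping); (SC-an) NOT ★ (waits on (FC-8) F3).

## References
* [BruhatTits1972] F. Bruhat, J. Tits, *Groupes réductifs sur un corps local I*, Publ. Math. IHÉS 41 (1972), (4.4.3) (`G = K A⁺ K`, `A ≤ N_G(K ∩ T)`).
* [Rogawski1990] J. D. Rogawski, *Automorphic Representations of Unitary Groups in Three Variables*, Ann. of Math. Stud. 123 (1990), §1.10 p. 9 (`M = {d(α, β, ᾱ⁻¹)}`).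
-/

set_option autoImplicit false
set_option linter.dupNamespace false  -- the mandated namespace repeats the single-problem summit's segment (`HodgeConjecture.HodgeConjecture`)

noncomputable section

open Set ValuativeRel Literature.NumberTheory.Automorphic Literature.NumberTheory.Automorphic.UnitaryGroup Literature.NumberTheory.Automorphic.HermitianLattice
open Summit.HodgeConjecture.HodgeConjecture.Cruxes.H413.K2E3DiagonalCollisionMeasure Summit.HodgeConjecture.HodgeConjecture.Cruxes.H413.K2E3FinConjCartanCover
open scoped MatrixGroups Pointwise WithZero

namespace Summit.HodgeConjecture.HodgeConjecture.Cruxes.H413.K2E3FinConjBoxTorusInvariant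

variable {K : Type*} [Field K] [Valued K ℤᵐ⁰] [ValuativeRel K] [(Valued.v : Valuation K ℤᵐ⁰).Compatible]
  (σ : K →+* K) (hσ : ∀ x, σ (σ x) = x) (hσv : ∀ x, Valued.v (σ x) = Valued.v x)

/-! ## §1 `t_a ∈ K₀` for `a ∈ 𝒪^×` -/

omit [ValuativeRel K] [(Valued.v : Valuation K ℤᵐ⁰).Compatible] in
/-- **A DIAGONAL UNITARY WITH UNIT ENTRIES IS IN `K₀ = U ∩ GL₃(𝒪)`**: if `|d_k| = 1` for all `k` then `diag(d)` and `diag(d)⁻¹ = diag(d⁻¹)` are integral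
(★ `mem_unitaryInt_iff`). [cite: BruhatTits1972, (4.4.3)] [cite: Rogawski1990, §1.10 p. 9] -/
theorem glDiagonal_mem_unitaryInt {J : Matrix (Fin 3) (Fin 3) K} {d : Fin 3 → Kˣ} (hd : ∀ k, Valued.v (d k : K) = 1)
    (hU : glDiagonal 3 K d ∈ unitaryGroupOfForm σ J) :
    (⟨glDiagonal 3 K d, hU⟩ : ↥(unitaryGroupOfForm σ J)) ∈ unitaryInt σ J := by
  rw [mem_unitaryInt_iff]
  refine ⟨fun i j => ?_, fun i j => ?_⟩
  · show Valued.v ((glDiagonal 3 K d : Matrix (Fin 3) (Fin 3) K) i j) ≤ 1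
    rw [coe_glDiagonal, Matrix.diagonal_apply]
    split_ifs
    · exact (hd i).le
    · rw [map_zero]; exact zero_le
  · show Valued.v ((((glDiagonal 3 K d)⁻¹ : GL (Fin 3) K) : Matrix (Fin 3) (Fin 3) K) i j) ≤ 1
    rw [← map_inv, coe_glDiagonal, Matrix.diagonal_apply]
    split_ifs
    · rw [Pi.inv_apply, Units.val_inv_eq_inv_val, map_inv₀, hd i, inv_one]
    · rw [map_zero]; exact zero_le

omit [ValuativeRel K] [(Valued.v : Valuation K ℤᵐ⁰).Compatible] in
include hσv in
/-- The entries `a, 1, σ(a)⁻¹` of `t_a` are units for `a ∈ 𝒪^×` (`σ` isometric). [cite: Rogawski1990, §1.10 p. 9] -/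
theorem v_torusOneVec_eq_one {a : Kˣ} (ha : Valued.v (a : K) = 1) (k : Fin 3) :
    Valued.v ((![a, 1, (Units.map (σ : K →* K) a)⁻¹] k : Kˣ) : K) = 1 := by
  have h3 : ∀ k : Fin 3, k = 0 ∨ k = 1 ∨ k = 2 := by decide
  rcases h3 k with rfl | rfl | rfl
  · exact ha
  · show Valued.v ((1 : Kˣ) : K) = 1
    rw [Units.val_one, map_one]
  · show Valued.v (((Units.map (σ : K →* K) a)⁻¹ : Kˣ) : K) = 1
    rw [Units.val_inv_eq_inv_val, Units.coe_map, MonoidHom.coe_coe, map_inv₀, hσv, ha, inv_one]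

include hσv in
/-- **`t_a = diag(a, 1, σ(a)⁻¹) ∈ K₀`** for `valuation a = 1` (the `ValuativeRel` unit sphere of (FC-D) = `Valued.v a = 1` by ★ `v_eq_one_iff_valuation_eq_one`).
[cite: BruhatTits1972, (4.4.3)] [cite: Rogawski1990, §1.10 p. 9] -/
theorem torusOne_mem_unitaryInt (a : Kˣ) (ha : valuation K (a : K) = 1) :
    (⟨glDiagonal 3 K ![a, 1, (Units.map (σ : K →* K) a)⁻¹], torusOne_mem_unitaryGroupOfForm σ hσ a⟩ :
        ↥(unitaryGroupOfForm σ ((StdForm.antidiagonal 3).over K))) ∈ unitaryInt σ ((StdForm.antidiagonal 3).over K) :=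
  glDiagonal_mem_unitaryInt σ (v_torusOneVec_eq_one σ hσv ((v_eq_one_iff_valuation_eq_one _).2 ha)) _

/-! ## §2 Diagonal elements of `U` commute -/

omit [Valued K ℤᵐ⁰] [ValuativeRel K] [(Valued.v : Valuation K ℤᵐ⁰).Compatible] in
/-- **Two elements of `U` with diagonal matrices commute.** [cite: Rogawski1990, §1.10 p. 9] -/
theorem mul_eq_mul_of_diagonal {J : Matrix (Fin 3) (Fin 3) K} (c t : ↥(unitaryGroupOfForm σ J)) {d e : Fin 3 → K}
    (hc : ((c : GL (Fin 3) K) : Matrix (Fin 3) (Fin 3) K) = Matrix.diagonal d) (ht : ((t : GL (Fin 3) K) : Matrix (Fin 3) (Fin 3) K) = Matrix.diagonal e) :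
    c * t = t * c := by
  refine Subtype.ext (Units.ext ?_)
  show ((c : GL (Fin 3) K) : Matrix (Fin 3) (Fin 3) K) * ((t : GL (Fin 3) K) : Matrix (Fin 3) (Fin 3) K) =
    ((t : GL (Fin 3) K) : Matrix (Fin 3) (Fin 3) K) * ((c : GL (Fin 3) K) : Matrix (Fin 3) (Fin 3) K)
  rw [hc, ht, Matrix.diagonal_mul_diagonal, Matrix.diagonal_mul_diagonal]
  congr 1
  funext k
  exact mul_comm _ _

omit [Valued K ℤᵐ⁰] [ValuativeRel K] [(Valued.v : Valuation K ℤᵐ⁰).Compatible] in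
/-- `c (t h) c⁻¹ = t (c h c⁻¹)` when `c` and `t` commute. [cite: Rogawski1990, §1.10 p. 9] -/
theorem conj_mul_eq_mul_conj {J : Matrix (Fin 3) (Fin 3) K} {c t : ↥(unitaryGroupOfForm σ J)} (hct : c * t = t * c) (h : ↥(unitaryGroupOfForm σ J)) :
    c * (t * h) * c⁻¹ = t * (c * h * c⁻¹) := by
  rw [← mul_assoc c t h, hct, mul_assoc t c h, mul_assoc t (c * h) c⁻¹]

/-! ## §3 The head: the box is `t_a`-invariant -/

include hσv in
/-- **THE BOX IS TORUS-INVARIANT** (head = K2E3-p23 (g4), `K2/STATUS.md` 2026-09-04T04:15:42Z): for `S₀ ⊆ U` any set, `c ∈ U = U(σ, Φ₃)(K)` with a DIAGONAL matrix, and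
`a ∈ 𝒪^×`: `t_a • (K₀S₀K₀ ∩ {h | c h c⁻¹ ∈ K₀S₀K₀}) = K₀S₀K₀ ∩ {h | c h c⁻¹ ∈ K₀S₀K₀}`, `K₀ = unitaryInt σ Φ₃`, `t_a = ⟨diag(a, 1, σ(a)⁻¹), _⟩` — since
`t_a ∈ K₀` (§1), `K₀S₀K₀` is left-`K₀`-invariant (★ F1 `mul_mem_box_iff`) and `c t_a = t_a c` (§2). [cite: BruhatTits1972, (4.4.3)] [cite: Rogawski1990, §1.10 p. 9] -/
theorem torusOne_smul_box_eq (S₀ : Set ↥(unitaryGroupOfForm σ ((StdForm.antidiagonal 3).over K)))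
    (c : ↥(unitaryGroupOfForm σ ((StdForm.antidiagonal 3).over K))) (d : Fin 3 → K)
    (hc : ((c : GL (Fin 3) K) : Matrix (Fin 3) (Fin 3) K) = Matrix.diagonal d) (a : Kˣ) (ha : valuation K (a : K) = 1) :
    (⟨glDiagonal 3 K ![a, 1, (Units.map (σ : K →* K) a)⁻¹], torusOne_mem_unitaryGroupOfForm σ hσ a⟩ : ↥(unitaryGroupOfForm σ ((StdForm.antidiagonal 3).over K))) •
      (((unitaryInt σ ((StdForm.antidiagonal 3).over K) : Set ↥(unitaryGroupOfForm σ ((StdForm.antidiagonal 3).over K))) * S₀ *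
          (unitaryInt σ ((StdForm.antidiagonal 3).over K) : Set ↥(unitaryGroupOfForm σ ((StdForm.antidiagonal 3).over K)))) ∩
        {h : ↥(unitaryGroupOfForm σ ((StdForm.antidiagonal 3).over K)) | c * h * c⁻¹ ∈
          (unitaryInt σ ((StdForm.antidiagonal 3).over K) : Set ↥(unitaryGroupOfForm σ ((StdForm.antidiagonal 3).over K))) * S₀ *
          (unitaryInt σ ((StdForm.antidiagonal 3).over K) : Set ↥(unitaryGroupOfForm σ ((StdForm.antidiagonal 3).over K)))}) =
      ((unitaryInt σ ((StdForm.antidiagonal 3).over K) : Set ↥(unitaryGroupOfForm σ ((StdForm.antidiagonal 3).over K))) * S₀ *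
          (unitaryInt σ ((StdForm.antidiagonal 3).over K) : Set ↥(unitaryGroupOfForm σ ((StdForm.antidiagonal 3).over K)))) ∩
        {h : ↥(unitaryGroupOfForm σ ((StdForm.antidiagonal 3).over K)) | c * h * c⁻¹ ∈
          (unitaryInt σ ((StdForm.antidiagonal 3).over K) : Set ↥(unitaryGroupOfForm σ ((StdForm.antidiagonal 3).over K))) * S₀ *
          (unitaryInt σ ((StdForm.antidiagonal 3).over K) : Set ↥(unitaryGroupOfForm σ ((StdForm.antidiagonal 3).over K)))} := by
  set t : ↥(unitaryGroupOfForm σ ((StdForm.antidiagonal 3).over K)) :=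
    ⟨glDiagonal 3 K ![a, 1, (Units.map (σ : K →* K) a)⁻¹], torusOne_mem_unitaryGroupOfForm σ hσ a⟩ with ht_def
  set K₀ : Subgroup ↥(unitaryGroupOfForm σ ((StdForm.antidiagonal 3).over K)) := unitaryInt σ ((StdForm.antidiagonal 3).over K) with hK₀
  have htK : t ∈ K₀ := torusOne_mem_unitaryInt σ hσ hσv a ha
  have htiK : t⁻¹ ∈ K₀ := K₀.inv_mem htK
  have htd : ((t : GL (Fin 3) K) : Matrix (Fin 3) (Fin 3) K) = Matrix.diagonal fun k => ((![a, 1, (Units.map (σ : K →* K) a)⁻¹] k : Kˣ) : K) :=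
    coe_glDiagonal 3 K _
  have hct : c * t = t * c := mul_eq_mul_of_diagonal σ c t hc htd
  have hcti : c * t⁻¹ = t⁻¹ * c := by
    rw [eq_inv_mul_iff_mul_eq, ← mul_assoc, ← hct, mul_assoc, mul_inv_cancel, mul_one]
  ext x
  rw [mem_smul_set_iff_inv_smul_mem, smul_eq_mul, mem_inter_iff, mem_inter_iff, mem_setOf_eq, mem_setOf_eq,
    mul_mem_box_iff K₀ S₀ htiK x, conj_mul_eq_mul_conj σ hcti x, mul_mem_box_iff K₀ S₀ htiK (c * x * c⁻¹)]

end Summit.HodgeConjecture.HodgeConjecture.Cruxes.H413.K2E3FinConjBoxTorusInvariant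

end
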